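import Literature.Barriers.RiemannHypothesis.TuranPartialSums
import Mathlib.Analysis.SpecialFunctions.Pow.Deriv
import Mathlib.Analysis.Calculus.MeanValue
import Mathlib.NumberTheory.Harmonic.Bounds
import HarnessLib

/-!
# Sections of `ζ` on the line `σ = 1`: an Euler–Maclaurin enclosure of `H_k(s) = ∑_{m ≤ k} m^{-s}`

Barrier catalogue `Literature/Barriers/RiemannHypothesis/`, companion of `TuranPartialSums.lean`
(step U1 of the plan to prove `TuranPartialSums`: the analytic input on the partial sums
`H_k(s) = zetaPartialSum k s` that the window checker of the `σ = 1` criterion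
(`TuranPartialSumsCriterion.lean`) evaluates in interval arithmetic). Everything here is PROVED.

For `Re s = 1`, `s ≠ 1` and integers `1 ≤ a ≤ b`:

* `norm_sum_Ioc_cpow_sub_le` —
  `‖∑_{a<m≤b} m^{-s} − (b^{1−s} − a^{1−s})/(1−s)‖ ≤ ‖s‖ (1/a² + 1/a)`
  (first-order Euler–Maclaurin: on `[m−1, m]` the antiderivative `x^{1−s}/(1−s)` of `x^{-s}` differs
  from `x ↦ x·m^{-s}` by a function whose derivative `x^{-s} − m^{-s}` has norm `≤ ‖s‖/(m−1)²`
  (mean value inequality for `x^{-s}`, `|d/dx x^{-s}| = ‖s‖ x^{-2}`), and `∑_{m>a} (m−1)^{-2} ≤ 1/a² + 1/a`);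
* `norm_zetaPartialSum_sub_sub_le` — the same for `H_b(s) − H_a(s)`;
* `norm_zetaPartialSum_sub_le_div` — `‖H_b(s) − H_a(s)‖ ≤ ∑_{a<m≤b} 1/m ≤ (b − a)/(a + 1)`;
* `norm_zetaPartialSum_le` — `‖H_k(s)‖ ≤ 1 + log k`.

## References

* [MontgomeryVaughan2007] H. L. Montgomery, R. C. Vaughan, *Multiplicative Number Theory I*,
  CUP 2007, Thm. 1.12 / (1.26) (partial sums of `n^{-s}` by Euler–Maclaurin).
* [PlattTrudgian2016] D. J. Platt, T. S. Trudgian, LMS J. Comput. Math. 19 (2016), §2.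
-/

noncomputable section

open Complex Finset Set

namespace Literature.Barriers.RiemannHypothesis

/-! ## `H_b − H_a` as a sum over `(a, b]` -/

/-- `H_b(s) − H_a(s) = ∑_{a < m ≤ b} m^{-s}` for `a ≤ b`. [folklore] -/
theorem zetaPartialSum_sub_eq_sum_Ioc_cpow {a b : ℕ} (hab : a ≤ b) (s : ℂ) :
    zetaPartialSum b s - zetaPartialSum a s = ∑ m ∈ Finset.Ioc a b, (m : ℂ) ^ (-s) := by
  simp only [zetaPartialSum]
  have hunion : Finset.Icc 1 b = Finset.Icc 1 a ∪ Finset.Ioc a b := by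
    ext m
    simp only [Finset.mem_union, Finset.mem_Icc, Finset.mem_Ioc]
    omega
  have hdisj : Disjoint (Finset.Icc 1 a) (Finset.Ioc a b) := by
    rw [Finset.disjoint_left]
    intro m hm hm'
    simp only [Finset.mem_Icc] at hm
    simp only [Finset.mem_Ioc] at hm'
    omega
  rw [hunion, Finset.sum_union hdisj]
  ring

/-! ## The mean value inequality for `x ↦ x^{-s}` on `[m − 1, m]` -/

/-- For real `x > 0` and `Re s = 1`: `‖x^{−s−1}‖ = x⁻²`. [folklore] -/
theorem norm_ofReal_cpow_neg_sub_one {s : ℂ} (hs : s.re = 1) {x : ℝ} (hx : 0 < x) :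
    ‖(x : ℂ) ^ (-s - 1)‖ = x⁻¹ ^ 2 := by
  rw [Complex.norm_cpow_eq_rpow_re_of_pos hx]
  have : (-s - 1).re = -2 := by simp [hs]; norm_num
  rw [this, Real.rpow_neg hx.le, Real.rpow_two, inv_pow]

/-- For real `x > 0` and `Re s = 1`: `‖x^{−s}‖ = x⁻¹`. [folklore] -/
theorem norm_ofReal_cpow_neg {s : ℂ} (hs : s.re = 1) {x : ℝ} (hx : 0 < x) :
    ‖(x : ℂ) ^ (-s)‖ = x⁻¹ := by
  rw [Complex.norm_cpow_eq_rpow_re_of_pos hx]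
  have : (-s).re = -1 := by simp [hs]
  rw [this, Real.rpow_neg_one]

/-- **Mean value inequality for `x^{-s}` on `[c, d]`, `1 ≤ c`** (`Re s = 1`): for `x, y ∈ [c, d]`,
`‖y^{-s} − x^{-s}‖ ≤ ‖s‖ c⁻² |y − x|`. [folklore] -/
theorem norm_cpow_neg_sub_cpow_neg_le {s : ℂ} (hs : s.re = 1) {c d : ℝ} (hc : 1 ≤ c)
    {x y : ℝ} (hx : x ∈ Icc c d) (hy : y ∈ Icc c d) :
    ‖(y : ℂ) ^ (-s) - (x : ℂ) ^ (-s)‖ ≤ ‖s‖ * c⁻¹ ^ 2 * ‖y - x‖ := by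
  have hs0 : s ≠ 0 := by
    intro h; rw [h] at hs; simp at hs
  -- derivative of `t ↦ (t:ℂ)^(-s)` is `-s * t^(-s-1)` at every `t ≠ 0`
  have hderiv : ∀ t ∈ Icc c d, HasDerivWithinAt (fun u : ℝ ↦ (u : ℂ) ^ (-s))
      (-s * (t : ℂ) ^ (-s - 1)) (Icc c d) t := by
    intro t ht
    have ht0 : t ≠ 0 := by linarith [ht.1]
    exact (hasDerivAt_ofReal_cpow_const ht0 (neg_ne_zero.2 hs0)).hasDerivWithinAt
  have hbound : ∀ t ∈ Icc c d, ‖-s * (t : ℂ) ^ (-s - 1)‖ ≤ ‖s‖ * c⁻¹ ^ 2 := by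
    intro t ht
    have ht0 : 0 < t := by linarith [ht.1]
    rw [norm_mul, norm_neg, norm_ofReal_cpow_neg_sub_one hs ht0]
    have h1 : t⁻¹ ≤ c⁻¹ := inv_anti₀ (by linarith) ht.1
    have h2 : (0 : ℝ) ≤ t⁻¹ := inv_nonneg.2 ht0.le
    exact mul_le_mul_of_nonneg_left (pow_le_pow_left₀ h2 h1 2) (norm_nonneg _)
  exact (convex_Icc c d).norm_image_sub_le_of_norm_hasDerivWithin_le hderiv hbound hx hy

/-- **One Euler–Maclaurin cell.** For `Re s = 1`, `s ≠ 1` and an integer `m ≥ 2`, with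
`F(x) = x^{1−s}/(1−s)`: `‖F(m) − F(m−1) − m^{-s}‖ ≤ ‖s‖/(m−1)²`. [cite: MontgomeryVaughan2007, Thm. 1.12] -/
theorem norm_cell_sub_cpow_le {s : ℂ} (hs : s.re = 1) (hs1 : s ≠ 1) {m : ℕ} (hm : 2 ≤ m) :
    ‖((m : ℂ) ^ (1 - s) / (1 - s) - ((m : ℂ) - 1) ^ (1 - s) / (1 - s)) - (m : ℂ) ^ (-s)‖
      ≤ ‖s‖ * ((m : ℝ) - 1)⁻¹ ^ 2 := by
  have hs0 : s ≠ 0 := by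
    intro h; rw [h] at hs; simp at hs
  have hr : (-s) ≠ -1 := fun h ↦ hs1 (by simpa using congrArg Neg.neg h)
  set c : ℝ := (m : ℝ) - 1 with hc
  have hc1 : 1 ≤ c := by
    have : (2 : ℝ) ≤ m := by exact_mod_cast hm
    rw [hc]; linarith
  have hcm : c + 1 = m := by rw [hc]; ring
  -- `G(x) = x^{1-s}/(1-s) - x * m^{-s}` on `[c, c+1]`
  set G : ℝ → ℂ := fun x ↦ (x : ℂ) ^ (-s + 1) / (-s + 1) - (x : ℂ) * (m : ℂ) ^ (-s) with hG
  have hGderiv : ∀ t ∈ Icc c (c + 1), HasDerivWithinAt G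
      ((t : ℂ) ^ (-s) - (m : ℂ) ^ (-s)) (Icc c (c + 1)) t := by
    intro t ht
    have ht0 : t ≠ 0 := by linarith [ht.1]
    have h1 : HasDerivAt (fun y : ℝ ↦ (y : ℂ) ^ (-s + 1) / (-s + 1)) ((t : ℂ) ^ (-s)) t :=
      hasDerivAt_ofReal_cpow_const' ht0 hr
    have h2 : HasDerivAt (fun y : ℝ ↦ (y : ℂ) * (m : ℂ) ^ (-s)) ((1 : ℂ) * (m : ℂ) ^ (-s)) t := by
      have : HasDerivAt (fun y : ℝ ↦ (y : ℂ)) 1 t := Complex.ofRealCLM.hasDerivAt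
      exact this.mul_const _
    have h3 : HasDerivAt G ((t : ℂ) ^ (-s) - 1 * (m : ℂ) ^ (-s)) t := h1.sub h2
    rw [one_mul] at h3
    exact h3.hasDerivWithinAt
  have hGbound : ∀ t ∈ Icc c (c + 1), ‖(t : ℂ) ^ (-s) - (m : ℂ) ^ (-s)‖ ≤ ‖s‖ * c⁻¹ ^ 2 := by
    intro t ht
    have hmI : (m : ℝ) ∈ Icc c (c + 1) := by rw [hcm]; exact ⟨by linarith, le_rfl⟩
    have h := norm_cpow_neg_sub_cpow_neg_le hs hc1 (d := c + 1) hmI ht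
    have htm : ‖t - (m : ℝ)‖ ≤ 1 := by
      rw [Real.norm_eq_abs, abs_le]; constructor <;> linarith [ht.1, ht.2, hcm]
    calc ‖(t : ℂ) ^ (-s) - (m : ℂ) ^ (-s)‖
        = ‖(t : ℂ) ^ (-s) - ((m : ℝ) : ℂ) ^ (-s)‖ := by norm_cast
      _ ≤ ‖s‖ * c⁻¹ ^ 2 * ‖t - (m : ℝ)‖ := h
      _ ≤ ‖s‖ * c⁻¹ ^ 2 * 1 := by gcongr
      _ = ‖s‖ * c⁻¹ ^ 2 := mul_one _
  have hMVT := (convex_Icc c (c + 1)).norm_image_sub_le_of_norm_hasDerivWithin_le hGderiv hGbound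
    (left_mem_Icc.2 (by linarith)) (right_mem_Icc.2 (by linarith))
  -- unfold `G` at the two endpoints
  have hGc1 : G (c + 1) = (m : ℂ) ^ (1 - s) / (1 - s) - (m : ℂ) * (m : ℂ) ^ (-s) := by
    simp only [hG]
    have : ((c + 1 : ℝ) : ℂ) = (m : ℂ) := by rw [hcm]; norm_cast
    rw [this, show -s + 1 = 1 - s by ring]
  have hGc : G c = ((m : ℂ) - 1) ^ (1 - s) / (1 - s) - ((m : ℂ) - 1) * (m : ℂ) ^ (-s) := by
    simp only [hG]
    have : ((c : ℝ) : ℂ) = (m : ℂ) - 1 := by rw [hc]; push_cast; ring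
    rw [this, show -s + 1 = 1 - s by ring]
  rw [hGc1, hGc] at hMVT
  have hnorm1 : ‖(c + 1 : ℝ) - c‖ = 1 := by simp
  rw [hnorm1, mul_one] at hMVT
  -- `m * m^{-s} - (m-1) * m^{-s} = m^{-s}`
  have key : (m : ℂ) ^ (1 - s) / (1 - s) - (m : ℂ) * (m : ℂ) ^ (-s) -
      (((m : ℂ) - 1) ^ (1 - s) / (1 - s) - ((m : ℂ) - 1) * (m : ℂ) ^ (-s)) =
      ((m : ℂ) ^ (1 - s) / (1 - s) - ((m : ℂ) - 1) ^ (1 - s) / (1 - s)) - (m : ℂ) ^ (-s) := by ring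
  rw [key] at hMVT
  simpa [hc] using hMVT

/-! ## Summing the cells -/

/-- Telescoping: `∑_{a<m≤b} (F m − F (m−1)) = F b − F a`. [folklore] -/
theorem sum_Ioc_sub_pred_eq {M : Type*} [AddCommGroup M] (F : ℕ → M) {a b : ℕ} (hab : a ≤ b) :
    ∑ m ∈ Finset.Ioc a b, (F m - F (m - 1)) = F b - F a := by
  induction b, hab using Nat.le_induction with
  | base => simp
  | succ n hn ih =>
    rw [Finset.sum_Ioc_succ_top (by omega), ih]
    simp only [Nat.add_sub_cancel]
    abel

/-- `∑_{a<m≤b} (m−1)⁻² ≤ a⁻² + a⁻¹` for `1 ≤ a`. [folklore] -/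
theorem sum_Ioc_inv_pred_sq_le {a b : ℕ} (ha : 1 ≤ a) (hab : a ≤ b) :
    ∑ m ∈ Finset.Ioc a b, ((m : ℝ) - 1)⁻¹ ^ 2 ≤ (a : ℝ)⁻¹ ^ 2 + (a : ℝ)⁻¹ := by
  -- stronger statement with a telescoping slack `−1/(b−1)` once `b ≥ a+1`
  rcases Nat.eq_or_lt_of_le hab with rfl | hlt
  · simp; positivity
  have main : ∀ b : ℕ, a + 1 ≤ b →
      ∑ m ∈ Finset.Ioc a b, ((m : ℝ) - 1)⁻¹ ^ 2 ≤ (a : ℝ)⁻¹ ^ 2 + (a : ℝ)⁻¹ - ((b : ℝ) - 1)⁻¹ := by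
    intro b hb
    induction b, hb using Nat.le_induction with
    | base =>
      rw [Finset.sum_Ioc_succ_top (by omega), Finset.Ioc_self, Finset.sum_empty, zero_add]
      push_cast
      ring_nf
      rfl
    | succ n hn ih =>
      rw [Finset.sum_Ioc_succ_top (by omega)]
      have hn1 : (1 : ℝ) ≤ (n : ℝ) - 1 := by
        have : (a : ℝ) + 1 ≤ n := by exact_mod_cast hn
        have : (1 : ℝ) ≤ a := by exact_mod_cast ha
        linarith
      have hstep : (((n + 1 : ℕ) : ℝ) - 1)⁻¹ ^ 2 ≤ ((n : ℝ) - 1)⁻¹ - (((n + 1 : ℕ) : ℝ) - 1)⁻¹ := by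
        push_cast
        rw [show (n : ℝ) + 1 - 1 = n by ring]
        have hn0 : (0 : ℝ) < n := by linarith
        have hn0' : (0 : ℝ) < (n : ℝ) - 1 := by linarith
        rw [inv_pow, ← one_div, ← one_div, ← one_div, div_sub_div _ _ hn0'.ne' hn0.ne',
          div_le_div_iff₀ (by positivity) (by positivity)]
        nlinarith
      linarith
  have h := main b hlt
  have hb1 : (0 : ℝ) ≤ ((b : ℝ) - 1)⁻¹ := by
    have : (a : ℝ) + 1 ≤ b := by exact_mod_cast hlt
    have : (1 : ℝ) ≤ a := by exact_mod_cast ha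
    exact inv_nonneg.2 (by linarith)
  linarith

/-- **First-order Euler–Maclaurin enclosure of `∑_{a<m≤b} m^{-s}` on `Re s = 1`.** For `s ≠ 1`
and integers `1 ≤ a ≤ b`:
`‖∑_{a<m≤b} m^{-s} − (b^{1−s} − a^{1−s})/(1−s)‖ ≤ ‖s‖ (a⁻² + a⁻¹)`.
[cite: MontgomeryVaughan2007, Thm. 1.12] -/
theorem norm_sum_Ioc_cpow_sub_le {s : ℂ} (hs : s.re = 1) (hs1 : s ≠ 1) {a b : ℕ} (ha : 1 ≤ a)
    (hab : a ≤ b) :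
    ‖∑ m ∈ Finset.Ioc a b, (m : ℂ) ^ (-s) -
        ((b : ℂ) ^ (1 - s) / (1 - s) - (a : ℂ) ^ (1 - s) / (1 - s))‖
      ≤ ‖s‖ * ((a : ℝ)⁻¹ ^ 2 + (a : ℝ)⁻¹) := by
  set F : ℕ → ℂ := fun m ↦ (m : ℂ) ^ (1 - s) / (1 - s) with hF
  have htel := sum_Ioc_sub_pred_eq F hab
  have hsplit : ∑ m ∈ Finset.Ioc a b, (m : ℂ) ^ (-s) - (F b - F a) =
      ∑ m ∈ Finset.Ioc a b, ((m : ℂ) ^ (-s) - (F m - F (m - 1))) := by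
    rw [Finset.sum_sub_distrib, htel]
  rw [show (b : ℂ) ^ (1 - s) / (1 - s) - (a : ℂ) ^ (1 - s) / (1 - s) = F b - F a by rfl, hsplit]
  calc ‖∑ m ∈ Finset.Ioc a b, ((m : ℂ) ^ (-s) - (F m - F (m - 1)))‖
      ≤ ∑ m ∈ Finset.Ioc a b, ‖(m : ℂ) ^ (-s) - (F m - F (m - 1))‖ := norm_sum_le _ _
    _ ≤ ∑ m ∈ Finset.Ioc a b, ‖s‖ * ((m : ℝ) - 1)⁻¹ ^ 2 := by
        refine Finset.sum_le_sum fun m hm ↦ ?_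
        rw [Finset.mem_Ioc] at hm
        have hm2 : 2 ≤ m := by omega
        have hcell := norm_cell_sub_cpow_le hs hs1 hm2
        have hFm : F m - F (m - 1) =
            (m : ℂ) ^ (1 - s) / (1 - s) - ((m : ℂ) - 1) ^ (1 - s) / (1 - s) := by
          simp only [hF]
          have : ((m - 1 : ℕ) : ℂ) = (m : ℂ) - 1 := by
            rw [Nat.cast_sub (by omega)]; simp
          rw [this]
        rw [hFm, norm_sub_rev]
        exact hcell
    _ = ‖s‖ * ∑ m ∈ Finset.Ioc a b, ((m : ℝ) - 1)⁻¹ ^ 2 := by rw [Finset.mul_sum]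
    _ ≤ ‖s‖ * ((a : ℝ)⁻¹ ^ 2 + (a : ℝ)⁻¹) := by
        gcongr
        exact sum_Ioc_inv_pred_sq_le ha hab

/-- The same for the sections of `ζ`: `‖H_b(s) − H_a(s) − (b^{1−s} − a^{1−s})/(1−s)‖ ≤ ‖s‖(a⁻² + a⁻¹)`
(`Re s = 1`, `s ≠ 1`, `1 ≤ a ≤ b`). [cite: MontgomeryVaughan2007, Thm. 1.12] -/
theorem norm_zetaPartialSum_sub_sub_le {s : ℂ} (hs : s.re = 1) (hs1 : s ≠ 1) {a b : ℕ} (ha : 1 ≤ a)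
    (hab : a ≤ b) :
    ‖zetaPartialSum b s - zetaPartialSum a s -
        ((b : ℂ) ^ (1 - s) / (1 - s) - (a : ℂ) ^ (1 - s) / (1 - s))‖
      ≤ ‖s‖ * ((a : ℝ)⁻¹ ^ 2 + (a : ℝ)⁻¹) := by
  rw [zetaPartialSum_sub_eq_sum_Ioc_cpow hab]
  exact norm_sum_Ioc_cpow_sub_le hs hs1 ha hab

/-! ## Crude bounds: variation and size of `H_k` -/

/-- `‖H_b(s) − H_a(s)‖ ≤ ∑_{a<m≤b} 1/m` on `Re s = 1` (`a ≤ b`). [folklore] -/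
theorem norm_zetaPartialSum_sub_le_sum {s : ℂ} (hs : s.re = 1) {a b : ℕ} (hab : a ≤ b) :
    ‖zetaPartialSum b s - zetaPartialSum a s‖ ≤ ∑ m ∈ Finset.Ioc a b, ((m : ℝ))⁻¹ := by
  rw [zetaPartialSum_sub_eq_sum_Ioc_cpow hab]
  refine (norm_sum_le _ _).trans (Finset.sum_le_sum fun m hm ↦ ?_)
  rw [Finset.mem_Ioc] at hm
  have hm0 : (0 : ℝ) < m := by exact_mod_cast (show 0 < m by omega)
  have := norm_ofReal_cpow_neg hs hm0
  rw [show ((m : ℝ) : ℂ) = (m : ℂ) by norm_cast] at this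
  rw [this]

/-- `‖H_b(s) − H_a(s)‖ ≤ (b − a)/(a + 1)` on `Re s = 1` (`a ≤ b`). [folklore] -/
theorem norm_zetaPartialSum_sub_le_div {s : ℂ} (hs : s.re = 1) {a b : ℕ} (hab : a ≤ b) :
    ‖zetaPartialSum b s - zetaPartialSum a s‖ ≤ ((b : ℝ) - a) / ((a : ℝ) + 1) := by
  refine (norm_zetaPartialSum_sub_le_sum hs hab).trans ?_
  calc ∑ m ∈ Finset.Ioc a b, ((m : ℝ))⁻¹ ≤ ∑ _m ∈ Finset.Ioc a b, ((a : ℝ) + 1)⁻¹ := by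
        refine Finset.sum_le_sum fun m hm ↦ ?_
        rw [Finset.mem_Ioc] at hm
        have : (a : ℝ) + 1 ≤ m := by exact_mod_cast hm.1
        exact inv_anti₀ (by positivity) this
    _ = ((b : ℝ) - a) / ((a : ℝ) + 1) := by
        rw [Finset.sum_const, Nat.card_Ioc, nsmul_eq_mul, Nat.cast_sub hab, div_eq_mul_inv]

/-- `‖H_k(s)‖ ≤ 1 + log k` on `Re s = 1`. [folklore] -/
theorem norm_zetaPartialSum_le {s : ℂ} (hs : s.re = 1) (k : ℕ) :
    ‖zetaPartialSum k s‖ ≤ 1 + Real.log k := by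
  have h0 := norm_zetaPartialSum_sub_le_sum hs (Nat.zero_le k)
  rw [zetaPartialSum_zero, sub_zero] at h0
  refine h0.trans ?_
  have hh := harmonic_le_one_add_log k
  rw [harmonic_eq_sum_Icc] at hh
  push_cast at hh
  have : Finset.Ioc 0 k = Finset.Icc 1 k := by ext m; simp [Finset.mem_Ioc, Finset.mem_Icc]; omega
  rw [this]
  exact_mod_cast hh

end Literature.Barriers.RiemannHypothesis
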